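import Summits.CriticalPhenomena.PercolationContinuityZ3.Theorems.PercNearOneGluingAdditiveGluingKnBadBound
import HarnessLib

/-!
# `NoHeavyLowerTail` (stmt-CriticalPhenomena-4575) — three relays: KN Lemma 3(ii) in pair form and the second transfer
# `Δ ≤ m₂ᴹ` under the WITHIN-PAIR order `τ₃ ≤ τ₂` (gen 6, `nh-dp-commonrelay`)

Support file (`--supports stmt-CriticalPhenomena-4575`); no definitions, no named facts, no sorries.  Setting and notation of
`…SectorTransfer` (Kozma–Nitzan, Theorem 2 / Question 7 at `|A| = 3`): target `b`, relays `a₁, a₂, a₃`, `D = N₁₂ = {a₃ ↮ a₁, a₂}`,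
`M` = all three relays separated, `m_T = μ(C(b) ∩ A = T)`, `m₂ᴹ = μ(M ∩ {a₂↔b})`, `m₃ᴹ = μ(M ∩ {a₃↔b})`, `τᵢ = μ(aᵢ↔b)`.
* `sector_lemma3ii_pair` (PROVED): KN Lemma 3(ii) with the decreasing event `Q = {a₃ ↮ a₁}` of the cluster of the weaker relay:
  `τ₃ ≤ τ₂ ⟹ μ(D ∩ {a₃↔b}) ≤ μ(D ∩ {a₂↔b})` (BHK Thms 1.3/1.4 in the set forms `stub_bhkSets`, through `{a₂ ↮ a₃}`); this is
  eq. (12)/(13) of KN's proof of Theorem 3, in general (non-separating) form.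
* `sector_delta_le_m2M` (PROVED): `τ₃ ≤ τ₂ ⟹ m₃ ≤ m₁₂ + m₂ᴹ`, i.e. `Δ = m₃ − m₁₂ ≤ μ(M, a₂↔b)`.  Together with `sector_delta_le` of
  `…SectorTransfer` (at `(a₂,a₁)`: `τ₃ ≤ τ₂ ⟹ Δ ≤ m₃ᴹ`) the regime excess `Δ` is at most `min(m₂ᴹ, m₃ᴹ)` under `τ₃ ≤ τ₂` ALONE.
* `sectorII_pair_arith`: the real arithmetic turning the hypothesis-free symmetric row
  `Σmin : (P₁ Mo₁ − P_M A₁) · min(m₂ᴹ, m₃ᴹ) ≤ P_M (P₁ (T₁−U₁) − A₁ (m₁−m₂₃))` plus the two transfers into the sector inequality (II)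
  (`P_M A₁ (τ₁−τ₃) + P₁ Mo₁ (m₃−m₁₂) ≤ P₁ P_M (T₁−U₁)`, registered as `stub_sectorII`); the assembled statements
  (`sectorII_of_sigmaMin`, `preFKG3_of_claimI_sigmaMin`) follow in `…SectorPairAssembly` once `…SectorTransfer` is built on the farm.
  Consequence: sector II needs only `τ₃ ≤ τ₂`, sector III only `τ₃ ≤ τ₁` — the two-sided minimiser hypothesis of KN Q7@3 is
  discharged through these Lemma-3 transfers (the one-sided form with `τ₃ ≤ τ₁` alone is FALSE: `…SectorOneSidedCex`).
  `Σmin` is conjectural (0 violations on the complete ttrl2 `sigma1` hard-corner bank, 36 666 labellings, where the asymmetric rows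
  `Σ₁`, `T1b`, `Ξ₁` die; memo RESIDUAL-gen6.md in run/shared/lean/prim/prim-nh-dp-commonrelay/).
[cite: KozmaNitzan2024, Lemma 3 (pp. 6–7), Theorem 2 (pp. 8–9), Theorem 3 proof eqs. (12)–(13) (p. 11), Question 7 (p. 36);
VandenbergHaggstromKahn2005, Thms. 1.3–1.4]
-/


namespace Summit.CriticalPhenomena.PercolationContinuityZ3.Theorems

open MeasureTheory Set Literature.Probability.LatticeModels Literature.Probability.Percolation

noncomputable section
open Classical

variable {n : ℕ}

/-! ### Set bookkeeping -/

/-- `{S ↮ X}` for `S = {a₃}`, `X = {a₂} ⊆ V` is `{a₂ ↮ a₃}`. [folklore] -/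
theorem sectorPair_sep_set (a₂ a₃ : Fin n) :
    {ω : BondConfig (Fin n) | ∀ s ∈ ({a₃} : Finset (Fin n)), ∀ x ∈ ({a₂} : Set (Fin n)),
        ¬ (openGraph ω).Reachable s x} = (openConn a₂ a₃)ᶜ := by
  ext ω
  simp only [Finset.mem_singleton, Set.mem_singleton_iff, forall_eq, Set.mem_setOf_eq, Set.mem_compl_iff,
    knThm2_mem_openConn]
  exact ⟨fun h h' => h h'.symm, fun h h' => h h'.symm⟩

/-- On `{a₂ ↮ a₃}`: `{a₃↔b} ∖ {a₁↔a₃} = D ∩ {a₃↔b}`. [folklore] -/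
theorem sectorPair_k3_sdiff (b a₁ a₂ a₃ : Fin n) :
    (((openConn a₂ a₃)ᶜ ∩ openConn a₃ b) \ openConn a₁ a₃ : Set (BondConfig (Fin n))) =
      (openConn a₁ a₃)ᶜ ∩ (openConn a₂ a₃)ᶜ ∩ openConn a₃ b := by
  ext ω
  simp only [Set.mem_sdiff, Set.mem_inter_iff, Set.mem_compl_iff]
  tauto

/-- On `{a₂ ↮ a₃}`: `{a₂↔b} ∖ {a₁↔a₃} = D ∩ {a₂↔b}`. [folklore] -/
theorem sectorPair_k2_sdiff (b a₁ a₂ a₃ : Fin n) :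
    (((openConn a₂ a₃)ᶜ ∩ openConn a₂ b) \ openConn a₁ a₃ : Set (BondConfig (Fin n))) =
      (openConn a₁ a₃)ᶜ ∩ (openConn a₂ a₃)ᶜ ∩ openConn a₂ b := by
  ext ω
  simp only [Set.mem_sdiff, Set.mem_inter_iff, Set.mem_compl_iff]
  tauto

/-- On `{a₂ ↮ a₃}`: `{a₃↔b} ∩ {a₁↔a₃} = {a₃↔b} ∩ {a₃↔a₁}` (orientation). [folklore] -/
theorem sectorPair_k3_inter (b a₁ a₂ a₃ : Fin n) :
    (((openConn a₂ a₃)ᶜ ∩ openConn a₃ b) ∩ openConn a₁ a₃ : Set (BondConfig (Fin n))) =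
      (openConn a₂ a₃)ᶜ ∩ (openConn a₃ b ∩ openConn a₃ a₁) := by
  rw [knThm2_openConn_comm a₁ a₃, Set.inter_assoc]

/-- On `{a₂ ↮ a₃}`: `{a₂↔b} ∩ {a₁↔a₃} = {a₂↔b} ∩ {a₃↔a₁}` (orientation). [folklore] -/
theorem sectorPair_k2_inter (b a₁ a₂ a₃ : Fin n) :
    (((openConn a₂ a₃)ᶜ ∩ openConn a₂ b) ∩ openConn a₁ a₃ : Set (BondConfig (Fin n))) =
      (openConn a₂ a₃)ᶜ ∩ (openConn a₂ b ∩ openConn a₃ a₁) := by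
  rw [knThm2_openConn_comm a₁ a₃, Set.inter_assoc]

/-- The common part of `{a₃↔b}` and `{a₂↔b}` with `{a₂↔a₃}` coincide. [folklore] -/
theorem sectorPair_common (b a₂ a₃ : Fin n) :
    (openConn a₃ b ∩ openConn a₂ a₃ : Set (BondConfig (Fin n))) = openConn a₂ b ∩ openConn a₂ a₃ := by
  ext ω
  simp only [Set.mem_inter_iff, knThm2_mem_openConn]
  exact ⟨fun ⟨h3b, h23⟩ => ⟨h23.trans h3b, h23⟩, fun ⟨h2b, h23⟩ => ⟨h23.symm.trans h2b, h23⟩⟩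

/-! ### KN Lemma 3(ii) with `Q = {a₃ ↮ a₁}` -/

/-- **KN Lemma 3(ii) with the decreasing event `Q = {a₃ ↮ a₁}` of the cluster of the weaker relay `a₃` (PROVED):**
if `τ₃ ≤ τ₂` then `μ(a₃↮a₁, a₃↮a₂, a₃↔b) ≤ μ(a₃↮a₁, a₃↮a₂, a₂↔b)`, i.e. `μ(D ∩ {a₃↔b}) ≤ μ(D ∩ {a₂↔b})`.
KN's proof: on `S = {a₂ ↮ a₃}` the hypothesis reads `μ(S, a₃↔b) ≤ μ(S, a₂↔b)`; BHK Thm 1.3 (`{a₃↔b}`, `{a₃↔a₁}` both increasing in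
`C(a₃)`) lowers the left side under `Q`, BHK Thm 1.4 (`{a₂↔b}` in `C(a₂)`, `{a₃↔a₁}` in `C(a₃)`) raises the right side under `Q`.
[cite: KozmaNitzan2024, Lemma 3(ii) (pp. 6–7), eq. (12) (p. 11); VandenbergHaggstromKahn2005, Thms. 1.3–1.4] -/
theorem sector_lemma3ii_pair (w : Sym2 (Fin n) → unitInterval) (b a₁ a₂ a₃ : Fin n) (h23 : a₂ ≠ a₃)
    (hτ : (prodBernoulli w).real (openConn a₃ b) ≤ (prodBernoulli w).real (openConn a₂ b)) :
    (prodBernoulli w).real ((openConn a₁ a₃)ᶜ ∩ (openConn a₂ a₃)ᶜ ∩ openConn a₃ b) ≤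
      (prodBernoulli w).real ((openConn a₁ a₃)ᶜ ∩ (openConn a₂ a₃)ᶜ ∩ openConn a₂ b) := by
  -- BHK one-cluster (source `a₃`, avoiding `a₂`): `μ(S ∩ k₃) μ(S ∩ {a₃↔a₁}) ≤ μ(S) μ(S ∩ (k₃ ∩ {a₃↔a₁}))`
  have i1 := knThm2_bhkOne stub_bhkSets.1 w {a₃} ({a₂} : Set (Fin n)) b a₁ (by simp [h23.symm])
  rw [sectorPair_sep_set, Finset.set_biUnion_singleton, Finset.set_biInter_singleton] at i1
  -- BHK two-cluster (sources `a₂` | `a₃`): `μ(S) μ(S ∩ (k₂ ∩ {a₃↔a₁})) ≤ μ(S ∩ k₂) μ(S ∩ {a₃↔a₁})`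
  have i2 := knThm2_bhkTwo stub_bhkSets.2 w {a₂} {a₃} b a₁ (by simp [h23])
  rw [show {ω : BondConfig (Fin n) | ∀ s ∈ ({a₂} : Finset (Fin n)), ∀ x ∈ ({a₃} : Finset (Fin n)),
        ¬ (openGraph ω).Reachable s x} = (openConn a₂ a₃)ᶜ from by
      ext ω; simp only [Finset.mem_singleton, forall_eq, Set.mem_setOf_eq, Set.mem_compl_iff, knThm2_mem_openConn],
    Finset.set_biUnion_singleton, Finset.set_biInter_singleton] at i2
  -- the hypothesis on `S`: remove the common part `{a₂ ↔ a₃}`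
  have hs3 := measureReal_inter_add_sdiff (μ := prodBernoulli w) (s := (openConn a₃ b : Set (BondConfig (Fin n))))
    (t := openConn a₂ a₃) MeasurableSet.of_discrete
  have hs2 := measureReal_inter_add_sdiff (μ := prodBernoulli w) (s := (openConn a₂ b : Set (BondConfig (Fin n))))
    (t := openConn a₂ a₃) MeasurableSet.of_discrete
  have ed3 : (openConn a₃ b \ openConn a₂ a₃ : Set (BondConfig (Fin n))) = (openConn a₂ a₃)ᶜ ∩ openConn a₃ b := by
    ext ω; simp only [Set.mem_sdiff, Set.mem_inter_iff, Set.mem_compl_iff]; tauto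
  have ed2 : (openConn a₂ b \ openConn a₂ a₃ : Set (BondConfig (Fin n))) = (openConn a₂ a₃)ᶜ ∩ openConn a₂ b := by
    ext ω; simp only [Set.mem_sdiff, Set.mem_inter_iff, Set.mem_compl_iff]; tauto
  rw [sectorPair_common, ed3] at hs3
  rw [ed2] at hs2
  have hS : (prodBernoulli w).real ((openConn a₂ a₃)ᶜ ∩ openConn a₃ b) ≤
      (prodBernoulli w).real ((openConn a₂ a₃)ᶜ ∩ openConn a₂ b) := by linarith
  -- split `S ∩ k₃`, `S ∩ k₂` and `S` by `{a₁ ↔ a₃}`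
  have hk3 := measureReal_inter_add_sdiff (μ := prodBernoulli w)
    (s := ((openConn a₂ a₃)ᶜ ∩ openConn a₃ b : Set (BondConfig (Fin n)))) (t := openConn a₁ a₃) MeasurableSet.of_discrete
  have hk2 := measureReal_inter_add_sdiff (μ := prodBernoulli w)
    (s := ((openConn a₂ a₃)ᶜ ∩ openConn a₂ b : Set (BondConfig (Fin n)))) (t := openConn a₁ a₃) MeasurableSet.of_discrete
  have hS0 := measureReal_inter_add_sdiff (μ := prodBernoulli w)
    (s := ((openConn a₂ a₃)ᶜ : Set (BondConfig (Fin n)))) (t := openConn a₁ a₃) MeasurableSet.of_discrete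
  rw [sectorPair_k3_sdiff, sectorPair_k3_inter] at hk3
  rw [sectorPair_k2_sdiff, sectorPair_k2_inter] at hk2
  have eQ : (((openConn a₂ a₃)ᶜ : Set (BondConfig (Fin n))) ∩ openConn a₁ a₃) = (openConn a₂ a₃)ᶜ ∩ openConn a₃ a₁ := by
    rw [knThm2_openConn_comm a₁ a₃]
  have eQ' : (((openConn a₂ a₃)ᶜ : Set (BondConfig (Fin n))) \ openConn a₁ a₃) = (openConn a₁ a₃)ᶜ ∩ (openConn a₂ a₃)ᶜ := by
    ext ω; simp only [Set.mem_sdiff, Set.mem_inter_iff, Set.mem_compl_iff]; tauto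
  rw [eQ, eQ'] at hS0
  -- abbreviations
  set PS := (prodBernoulli w).real ((openConn a₂ a₃)ᶜ : Set (BondConfig (Fin n))) with hPS
  set K3 := (prodBernoulli w).real ((openConn a₂ a₃)ᶜ ∩ openConn a₃ b) with hK3
  set K2 := (prodBernoulli w).real ((openConn a₂ a₃)ᶜ ∩ openConn a₂ b) with hK2
  set R := (prodBernoulli w).real ((openConn a₂ a₃)ᶜ ∩ openConn a₃ a₁) with hR
  set K3R := (prodBernoulli w).real ((openConn a₂ a₃)ᶜ ∩ (openConn a₃ b ∩ openConn a₃ a₁)) with hK3R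
  set K2R := (prodBernoulli w).real ((openConn a₂ a₃)ᶜ ∩ (openConn a₂ b ∩ openConn a₃ a₁)) with hK2R
  set D3 := (prodBernoulli w).real ((openConn a₁ a₃)ᶜ ∩ (openConn a₂ a₃)ᶜ ∩ openConn a₃ b) with hD3
  set D2 := (prodBernoulli w).real ((openConn a₁ a₃)ᶜ ∩ (openConn a₂ a₃)ᶜ ∩ openConn a₂ b) with hD2
  set PD := (prodBernoulli w).real ((openConn a₁ a₃)ᶜ ∩ (openConn a₂ a₃)ᶜ : Set (BondConfig (Fin n))) with hPD
  -- i1 : K3 * R ≤ PS * K3R ; i2 : PS * K2R ≤ K2 * R ; hk3 : K3 = K3R + D3 ; hk2 : K2 = K2R + D2 ; hS0 : PS = R + PD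
  have hD3nn : 0 ≤ D3 := measureReal_nonneg
  have hK2nn : 0 ≤ K2 := measureReal_nonneg
  have hPDnn : 0 ≤ PD := measureReal_nonneg
  have e1 : PS * K3R + PS * D3 = PS * K3 := by rw [← hk3]; ring
  have e2 : K3 * R + K3 * PD = K3 * PS := by rw [← hS0]; ring
  have e3 : PS * K2R + PS * D2 = PS * K2 := by rw [← hk2]; ring
  have e4 : K2 * R + K2 * PD = K2 * PS := by rw [← hS0]; ring
  have c1 : PS * D3 ≤ K3 * PD := by linarith [i1, e1, e2]
  have c2 : K2 * PD ≤ PS * D2 := by linarith [i2, e3, e4]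
  have c3 : K3 * PD ≤ K2 * PD := mul_le_mul_of_nonneg_right hS hPDnn
  have hchain : PS * D3 ≤ PS * D2 := by linarith
  by_cases hPS0 : PS = 0
  · have h0 : D3 = 0 := by
      refine le_antisymm ?_ hD3nn
      calc D3 ≤ PS := by
            rw [hD3, hPS]; exact measureReal_mono (fun ω hω => hω.1.2)
        _ = 0 := hPS0
    rw [h0]; exact measureReal_nonneg
  · exact le_of_mul_le_mul_left hchain (lt_of_le_of_ne measureReal_nonneg (Ne.symm hPS0))

/-! ### The two transfers under the within-pair order `τ₃ ≤ τ₂` -/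

/-- `D ∩ {a₂↔b}` splits by `{a₁↔a₂}` into the pattern `m₁₂` and `M ∩ {a₂↔b}`: the part with `a₁ ↔ a₂`. [folklore] -/
theorem sectorPair_Dk2_inter (b a₁ a₂ a₃ : Fin n) :
    (((openConn a₁ a₃)ᶜ ∩ (openConn a₂ a₃)ᶜ ∩ openConn a₂ b) ∩ openConn a₁ a₂ : Set (BondConfig (Fin n))) =
      (openConn a₁ a₃)ᶜ ∩ (openConn a₂ a₃)ᶜ ∩ (openConn a₁ b ∩ openConn a₂ b) := by
  ext ω
  simp only [Set.mem_inter_iff, Set.mem_compl_iff, knThm2_mem_openConn]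
  constructor
  · rintro ⟨⟨hD, h2b⟩, h12⟩
    exact ⟨hD, h12.trans h2b, h2b⟩
  · rintro ⟨hD, h1b, h2b⟩
    exact ⟨⟨hD, h2b⟩, h1b.trans h2b.symm⟩

/-- … and the part with `a₁ ↮ a₂`. [folklore] -/
theorem sectorPair_Dk2_sdiff (b a₁ a₂ a₃ : Fin n) :
    (((openConn a₁ a₃)ᶜ ∩ (openConn a₂ a₃)ᶜ ∩ openConn a₂ b) \ openConn a₁ a₂ : Set (BondConfig (Fin n))) =
      (openConn a₁ a₂)ᶜ ∩ (openConn a₁ a₃)ᶜ ∩ (openConn a₂ a₃)ᶜ ∩ openConn a₂ b := by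
  ext ω
  simp only [Set.mem_sdiff, Set.mem_inter_iff, Set.mem_compl_iff]
  tauto

/-- **`Δ ≤ m₂ᴹ` under `τ₃ ≤ τ₂` (PROVED):** `m₃ ≤ m₁₂ + μ(M ∩ {a₂↔b})` — KN Lemma 3(ii) with `Q = {a₃↮a₁}`
(`sector_lemma3ii_pair`) and the split of `D ∩ {a₂↔b}` by `{a₁↔a₂}`.  This is eq. (13) of KN's proof of Theorem 3, in general
(non-separating) form. [cite: KozmaNitzan2024, Lemma 3(ii), eq. (13) (p. 11)] -/
theorem sector_delta_le_m2M (w : Sym2 (Fin n) → unitInterval) (b a₁ a₂ a₃ : Fin n) (h23 : a₂ ≠ a₃)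
    (hτ : (prodBernoulli w).real (openConn a₃ b) ≤ (prodBernoulli w).real (openConn a₂ b)) :
    (prodBernoulli w).real ((openConn a₁ a₃)ᶜ ∩ (openConn a₂ a₃)ᶜ ∩ openConn a₃ b) ≤
      (prodBernoulli w).real ((openConn a₁ a₃)ᶜ ∩ (openConn a₂ a₃)ᶜ ∩ (openConn a₁ b ∩ openConn a₂ b)) +
        (prodBernoulli w).real ((openConn a₁ a₂)ᶜ ∩ (openConn a₁ a₃)ᶜ ∩ (openConn a₂ a₃)ᶜ ∩ openConn a₂ b) := by
  have key := sector_lemma3ii_pair w b a₁ a₂ a₃ h23 hτ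
  have hsplit := measureReal_inter_add_sdiff (μ := prodBernoulli w)
    (s := ((openConn a₁ a₃)ᶜ ∩ (openConn a₂ a₃)ᶜ ∩ openConn a₂ b : Set (BondConfig (Fin n))))
    (t := openConn a₁ a₂) MeasurableSet.of_discrete
  rw [sectorPair_Dk2_inter, sectorPair_Dk2_sdiff] at hsplit
  linarith

/-! ### Real arithmetic -/

/-- **Arithmetic of `Σmin ⟹ (II)`**: with `Δ = m₃ − m₁₂ ≤ min(m₂ᴹ, m₃ᴹ)` and `P_M A₁ ≤ P₁ Mo₁`,
`P_M A₁ (τ₁−τ₃) + P₁ Mo₁ Δ = P_M A₁ (m₁−m₂₃) + (P₁ Mo₁ − P_M A₁) Δ ≤ P_M A₁ (m₁−m₂₃) + (P₁ Mo₁ − P_M A₁) min(m₂ᴹ, m₃ᴹ) ≤ P₁ P_M (T₁−U₁)`.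
[this file] -/
theorem sectorII_pair_arith {T₁ U₁ P₁ PM A₁ Mo₁ m₁₂ m₃ m₁ m₂₃ m₂M m₃M t₁ : ℝ}
    (hSig : (P₁ * Mo₁ - PM * A₁) * min m₂M m₃M ≤ PM * (P₁ * (T₁ - U₁) - A₁ * (m₁ - m₂₃)))
    (ht : t₁ = (m₁₂ + m₁) - (m₂₃ + m₃)) (hΔ2 : m₃ ≤ m₁₂ + m₂M) (hΔ3 : m₃ ≤ m₁₂ + m₃M) (hψ : PM * A₁ ≤ P₁ * Mo₁) :
    PM * A₁ * t₁ + P₁ * Mo₁ * (m₃ - m₁₂) ≤ P₁ * PM * (T₁ - U₁) := by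
  have hmin : m₃ - m₁₂ ≤ min m₂M m₃M := le_min (by linarith) (by linarith)
  have hkey : 0 ≤ (P₁ * Mo₁ - PM * A₁) * (min m₂M m₃M - (m₃ - m₁₂)) :=
    mul_nonneg (by linarith) (by linarith)
  rw [ht]
  nlinarith [hSig, hkey]

end

end Summit.CriticalPhenomena.PercolationContinuityZ3.Theorems
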